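import Literature.NumberTheory.Automorphic.GLnCongruenceCommutators   -- ★ (LH4-p02 g8): `commutator_mem_congruenceGL`, `valBound_mul_sub_one_sub_add`, `valBound_coe_inv_sub_one_add`; brings ★ `CongruenceSubgroupExpansionGL` (`K_m = 1 + ϖ^m M_n(𝒪)`, `conj_mem_congruenceGL`) and ★ `GLnCongruenceSubgroups` (`ValBound`, `congruenceGL`, `isUnit_det_and_valBound_inv`)
import HarnessLib

/-!
# Crux `H413` — K2-LIT E3 «EllipticInputs», U12-h engine (H1): THE CONGRUENCE LAYERS OF `GL_n(F)` — the layer map `k ↦ k − 1` identifies `K_γ ⧸ K_δ` with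
# `{X : entries ≤ γ} ⧸ {entries ≤ δ}` (cosets read on matrices), is onto, additive modulo `γγ'`, `GL_n(𝒪)`-equivariant and trivial under `K_γ` modulo `γ²`;
# dictionary `K_m ⧸ K_{m+e} ≅ M_n(𝒪) ⧸ ϖ^e` for `K_m = 1 + ϖ^m M_n(𝒪)`

Cell `hodgecm-mathlib`, Track B «K2-LIT», crux item `stmt-HodgeConjecture-24833` (h413), line `K2_E3_EllipticInputs`, unit U12 «HC characters», socket U12-h
`sig_K2E3CharLocConstNearRegular` (‹#9L›): the first brick (H0)+(H1) of Howe's Kirillov theory for congruence subgroups at SPLIT places (K2E3-p09 memo v3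
`K2/K2E3-p09/g0/MEMO-U12h-L5L6-statements.v3.K2E3-p09-g0.md` §2), rung suggested BY NAME for seat K2E1b-p08 (g2) by K2E3-p09 (g0) (K2 bus 2026-09-03T22:36:12Z) under
K2E3-plan (g1)'s BATCH #2∕#3; `--supports stmt-HodgeConjecture-24833 --as helper`.  THEOREMS ONLY — no `def`, no named fact, no instance, no notation, no `sorry`.
SURVEY-FIRST: (H0) «`⁅K_m, K_{m'}⁆ ⊆ K_{m+m'}`, products additive to second order, inverses, normality» is ALREADY ★ (`GLnCongruenceCommutators`,
`CongruenceSubgroupExpansionGL`) and is IMPORTED, not retyped; this file is (H1).  HONEST LABEL: HC_CM is proved only modulo the 7 printed citations (2 remaining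
named inputs: hLiu418 = stmt-HodgeConjecture-24832, h413 = stmt-HodgeConjecture-24833) until rung 0 closes; generic matrix algebra over a field with a `ValuativeRel`,
count-neutral.

SETTING (= ★ `GLnCongruenceSubgroups`).  `F` a field with a `ValuativeRel` (`v = valuation F`), `ValBound γ M` = «every entry of `M` has `v ≤ γ`», `K_γ := congruenceGL n γ`
= {`g`, `g⁻¹` integral, `g − 1`, `g⁻¹ − 1` with entries `≤ γ`}, `GL_n(𝒪) = glInt n F`; for a uniformizer `ϖ` (★ `IsUniformizingElement`), `K_m := K_{|ϖ|^m} = 1 + ϖ^m M_n(𝒪)`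
(★ `exists_eq_one_add_smul_of_mem_congruenceGL` ∕ `mem_congruenceGL_of_coe_eq_one_add_smul`).

THE MATHEMATICS [Howe1977Kirillov, §1; HarishChandra1999, §17 p. 80; Casselman1995, §1.4 Prop. 1.4.4; BernsteinZelevinsky1976, §3].  The «abelian layers» of the congruence
filtration: for `δ ≤ γ < 1` with `γ² ≤ δ` the quotient `K_γ ⧸ K_δ` is abelian and `k ↦ k − 1` is an isomorphism onto the additive group `{X : v(X_{ij}) ≤ γ} ⧸ {v ≤ δ}`,
equivariant for conjugation by `GL_n(𝒪)` — in particular `K_m ⧸ K_{2m} ≅ M_n(𝒪) ⧸ ϖ^m M_n(𝒪) ≅ M_n(𝒪 ⧸ ϖ^m)` with `GL_n(𝒪)` acting through `X ↦ κ X κ⁻¹`, the starting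
point of the orbit method for the characters of `K_m` (Howe) used in HC1999 §17.  Stated here ELEMENT-WISE (no quotient types, no `def`):
* §1 exact identities in `M_n(F)`: `kk' − 1 = (k−1) + (k'−1) + (k−1)(k'−1)`, `κkκ⁻¹ − 1 = κ(k−1)κ⁻¹`, `k⁻¹k' − 1 = k⁻¹(k' − k)`, `k'k⁻¹ − 1 = (k' − k)k⁻¹`;
* §2 **COSETS READ ON MATRICES**: for `k, k' ∈ GL_n(𝒪)` and ANY level `δ`, `k⁻¹k' ∈ K_δ ⟺ v(k' − k) ≤ δ ⟺ k'k⁻¹ ∈ K_δ` (`inv_mul_mem_congruenceGL_iff_valBound_sub`,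
  `mul_inv_mem_congruenceGL_iff_valBound_sub`) — injectivity of the layer map `K_γ ⧸ K_δ → {≤ γ} ⧸ {≤ δ}` and the coincidence of left and right cosets;
* §3 **ONTO**: every `X` with `v(X) ≤ γ < 1` is `k − 1` for a (unique) `k ∈ K_γ` (`exists_mem_congruenceGL_coe_eq_one_add`; ★ `isUnit_det_and_valBound_inv`);
* §4 **ADDITIVE AND `K_γ`-TRIVIAL MODULO `γγ'`**: `v(kk' − 1 − ((k−1)+(k'−1))) ≤ γγ'` (★ re-read on `GL_n`), `v(κkκ⁻¹ − k) ≤ γ'γ` for `κ ∈ K_{γ'}`, `k ∈ K_γ` (★ commutator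
  estimate: `κkκ⁻¹ = c·k`, `c ∈ K_{γ'γ}`), `v(k⁻¹ − (2 − k)) ≤ γ²` (★); and **EQUIVARIANCE**: `v(κ(k−1)κ⁻¹) ≤ γ` for `κ ∈ GL_n(𝒪)` (★ `valBound_coe_conj_sub_one`);
* §5 **THE `ϖ^m` DICTIONARY**: `v(Z) ≤ |ϖ|^e ⟺ Z ∈ ϖ^e M_n(𝒪)`; `v(ϖ^m Z) ≤ |ϖ|^{m+e} ⟺ v(Z) ≤ |ϖ|^e`; for `k = 1 + ϖ^m X`, `k' = 1 + ϖ^m Y` (`X, Y` integral, `m ≥ 1`):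
  **`k⁻¹k' ∈ K_{m+e} ⟺ Y − X ∈ ϖ^e M_n(𝒪)`** (`e ≤ m`; so `K_m ⧸ K_{m+e} ≅ M_n(𝒪 ⧸ ϖ^e)` as SETS, and as GROUPS by:) `kk' ≡ 1 + ϖ^m(X+Y)` and `k⁻¹ ≡ 1 − ϖ^m X` modulo
  `K_{2m}`, and `κkκ⁻¹ = 1 + ϖ^m (κXκ⁻¹)` with `κXκ⁻¹` integral for `κ ∈ GL_n(𝒪)`.

## References
* [Howe1977Kirillov] R. Howe, *Kirillov theory for compact p-adic groups*, Pacific J. Math. 73 (1977), 365–381, §1 (the groups `K_m = 1 + ϖ^m M_n(𝒪)` and their abelian layers).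
* [HarishChandra1999] Harish-Chandra (DeBacker–Sally), *Admissible Invariant Distributions on Reductive p-adic Groups*, ULECT 16 (1999), §17 p. 80 (the lattices `L`, `K = exp L`,
  `K^{1/2}`).
* [Casselman1995] W. Casselman, *Introduction to the theory of admissible representations of p-adic reductive groups* (draft 1995), §1.4 Prop. 1.4.4.
* [BernsteinZelevinsky1976] I. N. Bernstein, A. V. Zelevinsky, *Representations of the group GL(n, F) where F is a non-archimedean local field*, Russian Math. Surveys 31:3
  (1976), §3.
-/

set_option autoImplicit false
-- the mandated namespace repeats `HodgeConjecture.HodgeConjecture`, as in every `Theorems/*.lean` of this sub-problem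
set_option linter.dupNamespace false

noncomputable section

open scoped MatrixGroups
open Matrix ValuativeRel Literature.NumberTheory.Automorphic

namespace Summit.HodgeConjecture.HodgeConjecture.Cruxes.H413.K2E3CongruenceLayersGL

variable {F : Type*} [Field F] [ValuativeRel F] {n : ℕ}

/-! ## §1 Exact identities in `M_n(F)` for the layer map `k ↦ k − 1` -/

section Identities

omit [ValuativeRel F] in
/-- `k k' − 1 = (k − 1) + (k' − 1) + (k − 1)(k' − 1)` in `M_n(F)`: the layer map is additive up to the product of the two layers. [cite: Casselman1995, §1.4 Prop. 1.4.4] -/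
theorem coe_mul_sub_one (k k' : GL (Fin n) F) :
    ((k * k' : GL (Fin n) F) : Matrix (Fin n) (Fin n) F) - 1 =
      ((k : Matrix (Fin n) (Fin n) F) - 1) + ((k' : Matrix (Fin n) (Fin n) F) - 1) + ((k : Matrix (Fin n) (Fin n) F) - 1) * ((k' : Matrix (Fin n) (Fin n) F) - 1) := by
  rw [Units.val_mul]
  noncomm_ring

omit [ValuativeRel F] in
/-- `κ k κ⁻¹ − 1 = κ (k − 1) κ⁻¹` in `M_n(F)`: conjugation acts on the layer by conjugation. [cite: Howe1977Kirillov, §1] -/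
theorem coe_conj_sub_one (κ k : GL (Fin n) F) :
    ((κ * k * κ⁻¹ : GL (Fin n) F) : Matrix (Fin n) (Fin n) F) - 1 =
      (κ : Matrix (Fin n) (Fin n) F) * ((k : Matrix (Fin n) (Fin n) F) - 1) * ((κ⁻¹ : GL (Fin n) F) : Matrix (Fin n) (Fin n) F) := by
  rw [Matrix.mul_sub, Matrix.sub_mul, Matrix.mul_one, Units.val_mul, Units.val_mul,
    Matrix.mul_assoc (κ : Matrix (Fin n) (Fin n) F) (k : Matrix (Fin n) (Fin n) F), ← Units.val_mul, ← Units.val_mul, ← Units.val_mul, mul_inv_cancel, Units.val_one]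

omit [ValuativeRel F] in
/-- `k⁻¹ k' − 1 = k⁻¹ (k' − k)` in `M_n(F)`. [folklore] -/
theorem coe_inv_mul_sub_one (k k' : GL (Fin n) F) :
    ((k⁻¹ * k' : GL (Fin n) F) : Matrix (Fin n) (Fin n) F) - 1 =
      ((k⁻¹ : GL (Fin n) F) : Matrix (Fin n) (Fin n) F) * ((k' : Matrix (Fin n) (Fin n) F) - (k : Matrix (Fin n) (Fin n) F)) := by
  rw [Matrix.mul_sub, Units.val_mul, ← Units.val_mul k⁻¹ k, inv_mul_cancel, Units.val_one]

omit [ValuativeRel F] in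
/-- `k' k⁻¹ − 1 = (k' − k) k⁻¹` in `M_n(F)`. [folklore] -/
theorem coe_mul_inv_sub_one (k k' : GL (Fin n) F) :
    ((k' * k⁻¹ : GL (Fin n) F) : Matrix (Fin n) (Fin n) F) - 1 =
      ((k' : Matrix (Fin n) (Fin n) F) - (k : Matrix (Fin n) (Fin n) F)) * ((k⁻¹ : GL (Fin n) F) : Matrix (Fin n) (Fin n) F) := by
  rw [Matrix.sub_mul, Units.val_mul, ← Units.val_mul k, mul_inv_cancel, Units.val_one]

omit [ValuativeRel F] in
/-- `k' − k = k (k⁻¹ k' − 1)` in `M_n(F)`. [folklore] -/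
theorem coe_sub_coe_eq_mul (k k' : GL (Fin n) F) :
    (k' : Matrix (Fin n) (Fin n) F) - (k : Matrix (Fin n) (Fin n) F) =
      (k : Matrix (Fin n) (Fin n) F) * (((k⁻¹ * k' : GL (Fin n) F) : Matrix (Fin n) (Fin n) F) - 1) := by
  rw [coe_inv_mul_sub_one, ← Matrix.mul_assoc, ← Units.val_mul, mul_inv_cancel, Units.val_one, Matrix.one_mul]

end Identities

/-! ## §2 Cosets modulo a level, read on matrices -/

section Cosets

/-- **`k⁻¹ k' ∈ K_δ ⟺` the entries of `k' − k` are `≤ δ`**, for `k, k'` in `GL_n(𝒪)` and ANY level `δ` (`k⁻¹k' − 1 = k⁻¹(k' − k)`, `k'⁻¹k − 1 = k'⁻¹(k − k')`, `k' − k =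
k(k⁻¹k' − 1)` with integral outer factors).  This is the injectivity of the layer map `K_γ ⧸ K_δ → {v ≤ γ} ⧸ {v ≤ δ}`, `k ↦ k − 1`. [cite: Howe1977Kirillov, §1] [cite: BernsteinZelevinsky1976, §3] -/
theorem inv_mul_mem_congruenceGL_iff_valBound_sub {k k' : GL (Fin n) F} (hk : k ∈ glInt n F) (hk' : k' ∈ glInt n F) (δ : ValueGroupWithZero F) :
    k⁻¹ * k' ∈ congruenceGL n δ ↔ ValBound δ ((k' : Matrix (Fin n) (Fin n) F) - (k : Matrix (Fin n) (Fin n) F)) := by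
  constructor
  · intro h
    rw [coe_sub_coe_eq_mul]
    have h1 := (valBound_one_of_mem_glInt hk).mul h.2.1
    rwa [one_mul] at h1
  · intro h
    have hmem : k⁻¹ * k' ∈ glInt n F := Subgroup.mul_mem _ (Subgroup.inv_mem _ hk) hk'
    refine ⟨⟨valBound_one_of_mem_glInt hmem, valBound_one_of_mem_glInt (Subgroup.inv_mem _ hmem)⟩, ?_, ?_⟩
    · rw [coe_inv_mul_sub_one]
      have h1 := (valBound_one_of_mem_glInt (Subgroup.inv_mem _ hk)).mul h
      rwa [one_mul] at h1
    · rw [_root_.mul_inv_rev, inv_inv, coe_inv_mul_sub_one]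
      have h1 := (valBound_one_of_mem_glInt (Subgroup.inv_mem _ hk')).mul h.neg
      rwa [one_mul, neg_sub] at h1

/-- **`k' k⁻¹ ∈ K_δ ⟺` the entries of `k' − k` are `≤ δ`** (right cosets; `k'k⁻¹ − 1 = (k' − k)k⁻¹`): left and right cosets of `K_δ` in `GL_n(𝒪)` are read by the same matrix
congruence. [cite: Howe1977Kirillov, §1] [cite: BernsteinZelevinsky1976, §3] -/
theorem mul_inv_mem_congruenceGL_iff_valBound_sub {k k' : GL (Fin n) F} (hk : k ∈ glInt n F) (hk' : k' ∈ glInt n F) (δ : ValueGroupWithZero F) :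
    k' * k⁻¹ ∈ congruenceGL n δ ↔ ValBound δ ((k' : Matrix (Fin n) (Fin n) F) - (k : Matrix (Fin n) (Fin n) F)) := by
  constructor
  · intro h
    have e : (k' : Matrix (Fin n) (Fin n) F) - (k : Matrix (Fin n) (Fin n) F) =
        (((k' * k⁻¹ : GL (Fin n) F) : Matrix (Fin n) (Fin n) F) - 1) * (k : Matrix (Fin n) (Fin n) F) := by
      rw [coe_mul_inv_sub_one, Matrix.mul_assoc, ← Units.val_mul, inv_mul_cancel, Units.val_one, Matrix.mul_one]
    rw [e]
    have h1 := h.2.1.mul (valBound_one_of_mem_glInt hk)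
    rwa [mul_one] at h1
  · intro h
    have hmem : k' * k⁻¹ ∈ glInt n F := Subgroup.mul_mem _ hk' (Subgroup.inv_mem _ hk)
    refine ⟨⟨valBound_one_of_mem_glInt hmem, valBound_one_of_mem_glInt (Subgroup.inv_mem _ hmem)⟩, ?_, ?_⟩
    · rw [coe_mul_inv_sub_one]
      have h1 := h.mul (valBound_one_of_mem_glInt (Subgroup.inv_mem _ hk))
      rwa [mul_one] at h1
    · rw [_root_.mul_inv_rev, inv_inv, coe_mul_inv_sub_one]
      have h1 := h.neg.mul (valBound_one_of_mem_glInt (Subgroup.inv_mem _ hk'))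
      rwa [mul_one, neg_sub] at h1

/-- Same layer class from either side: `k⁻¹ k' ∈ K_δ ⟺ k' k⁻¹ ∈ K_δ` for `k, k' ∈ GL_n(𝒪)`. [cite: BernsteinZelevinsky1976, §3] -/
theorem inv_mul_mem_congruenceGL_iff_mul_inv_mem {k k' : GL (Fin n) F} (hk : k ∈ glInt n F) (hk' : k' ∈ glInt n F) (δ : ValueGroupWithZero F) :
    k⁻¹ * k' ∈ congruenceGL n δ ↔ k' * k⁻¹ ∈ congruenceGL n δ := by
  rw [inv_mul_mem_congruenceGL_iff_valBound_sub hk hk' δ, mul_inv_mem_congruenceGL_iff_valBound_sub hk hk' δ]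

/-- The diagonal case `k = 1`: for `k' ∈ GL_n(𝒪)`, `k' ∈ K_δ ⟺ v(k' − 1) ≤ δ` (the condition on `k'⁻¹ − 1` is then automatic). [cite: BernsteinZelevinsky1976, §3] -/
theorem mem_congruenceGL_iff_valBound_sub_one_of_mem_glInt {k' : GL (Fin n) F} (hk' : k' ∈ glInt n F) (δ : ValueGroupWithZero F) :
    k' ∈ congruenceGL n δ ↔ ValBound δ ((k' : Matrix (Fin n) (Fin n) F) - 1) := by
  have h := inv_mul_mem_congruenceGL_iff_valBound_sub (Subgroup.one_mem _) hk' δ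
  rwa [inv_one, one_mul, Units.val_one] at h

end Cosets

/-! ## §3 The layer map is onto `{X : v(X) ≤ γ}` for `γ < 1` -/

section Onto

/-- **Every matrix `X` with entries `≤ γ < 1` is `k − 1` for some `k ∈ K_γ`** (`k = 1 + X`: unit determinant and integral inverse `≡ 1 (γ)` by ★ `isUnit_det_and_valBound_inv`).
[cite: Howe1977Kirillov, §1] [cite: Casselman1995, §1.4 Prop. 1.4.4] -/
theorem exists_mem_congruenceGL_coe_eq_one_add {γ : ValueGroupWithZero F} (hγ : γ < 1) {X : Matrix (Fin n) (Fin n) F} (hX : ValBound γ X) :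
    ∃ k ∈ congruenceGL n γ, (k : Matrix (Fin n) (Fin n) F) = 1 + X := by
  have hX' : ValBound γ (1 + X - 1) := by rwa [add_sub_cancel_left]
  obtain ⟨hdet, hinv1, hinvγ⟩ := isUnit_det_and_valBound_inv hX' hγ
  refine ⟨Matrix.GeneralLinearGroup.mk'' (1 + X) hdet, ?_, rfl⟩
  have hcoe : (((Matrix.GeneralLinearGroup.mk'' (1 + X) hdet)⁻¹ : GL (Fin n) F) : Matrix (Fin n) (Fin n) F) = (1 + X)⁻¹ :=
    Matrix.coe_units_inv _
  refine ⟨⟨hX'.of_sub_one hγ.le, ?_⟩, hX', ?_⟩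
  · rw [hcoe]; exact hinv1
  · rw [hcoe]; exact hinvγ

omit [ValuativeRel F] in
/-- Uniqueness: two elements of `GL_n(F)` with the same layer image `k − 1` are equal. [folklore] -/
theorem eq_of_coe_sub_one_eq {k k' : GL (Fin n) F} (h : (k : Matrix (Fin n) (Fin n) F) - 1 = (k' : Matrix (Fin n) (Fin n) F) - 1) : k = k' :=
  Units.ext (sub_left_injective h)

end Onto

/-! ## §4 Additivity modulo `γγ'`, triviality of the `K_γ`-action on its own layer, equivariance under `GL_n(𝒪)` -/

section Layer

/-- **ADDITIVITY OF THE LAYER MAP MODULO `γγ'`**: for `k ∈ K_γ`, `k' ∈ K_{γ'}`, the entries of `kk' − 1 − ((k − 1) + (k' − 1)) = (k−1)(k'−1)` are `≤ γγ'` (★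
`valBound_mul_sub_one_sub_add` read on `GL_n`). [cite: Casselman1995, §1.4 Prop. 1.4.4] [cite: Howe1977Kirillov, §1] -/
theorem valBound_coe_mul_sub_one_sub_add {γ γ' : ValueGroupWithZero F} {k k' : GL (Fin n) F} (hk : k ∈ congruenceGL n γ) (hk' : k' ∈ congruenceGL n γ') :
    ValBound (γ * γ') (((k * k' : GL (Fin n) F) : Matrix (Fin n) (Fin n) F) - 1 - (((k : Matrix (Fin n) (Fin n) F) - 1) + ((k' : Matrix (Fin n) (Fin n) F) - 1))) := by
  rw [Units.val_mul]
  exact valBound_mul_sub_one_sub_add hk.2.1 hk'.2.1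

/-- In coset form: if `l ∈ GL_n(𝒪)` has `v(l − 1 − ((k−1) + (k'−1))) ≤ γγ'` (e.g. `l = 1 + (k−1) + (k'−1)` when that is in `K`), then `(kk')⁻¹ l ∈ K_{γγ'}` — the layer map is a
HOMOMORPHISM `K_γ → {v ≤ γ} ⧸ {v ≤ γ²}` (take `γ' = γ`). [cite: Howe1977Kirillov, §1] -/
theorem inv_mul_mem_congruenceGL_of_valBound_sub_one_sub_add {γ γ' : ValueGroupWithZero F} {k k' l : GL (Fin n) F} (hk : k ∈ congruenceGL n γ)
    (hk' : k' ∈ congruenceGL n γ') (hl : l ∈ glInt n F)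
    (hadd : ValBound (γ * γ') ((l : Matrix (Fin n) (Fin n) F) - 1 - (((k : Matrix (Fin n) (Fin n) F) - 1) + ((k' : Matrix (Fin n) (Fin n) F) - 1)))) :
    (k * k')⁻¹ * l ∈ congruenceGL n (γ * γ') := by
  rw [inv_mul_mem_congruenceGL_iff_valBound_sub (Subgroup.mul_mem _ (congruenceGL_le_glInt _ hk) (congruenceGL_le_glInt _ hk')) hl]
  have e : (l : Matrix (Fin n) (Fin n) F) - ((k * k' : GL (Fin n) F) : Matrix (Fin n) (Fin n) F) =
      ((l : Matrix (Fin n) (Fin n) F) - 1 - (((k : Matrix (Fin n) (Fin n) F) - 1) + ((k' : Matrix (Fin n) (Fin n) F) - 1))) -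
        (((k * k' : GL (Fin n) F) : Matrix (Fin n) (Fin n) F) - 1 - (((k : Matrix (Fin n) (Fin n) F) - 1) + ((k' : Matrix (Fin n) (Fin n) F) - 1))) := by
    abel
  rw [e]
  exact hadd.sub (valBound_coe_mul_sub_one_sub_add hk hk')

/-- **`K_{γ'}` MOVES THE LAYER OF `K_γ` ONLY MODULO `γ'γ`**: for `κ ∈ K_{γ'}` and `k ∈ K_γ` the entries of `κkκ⁻¹ − k` are `≤ γ'γ` (`κkκ⁻¹ = c·k` with the commutator
`c = κkκ⁻¹k⁻¹ ∈ K_{γ'γ}`, ★ `commutator_mem_congruenceGL`).  With `γ' = γ`: `K_γ` acts TRIVIALLY on `K_γ ⧸ K_{γ²}` — the layer is abelian and central modulo `γ²`.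
[cite: Howe1977Kirillov, §1] [cite: Casselman1995, §1.4 Prop. 1.4.4] -/
theorem valBound_coe_conj_sub_coe {γ γ' : ValueGroupWithZero F} {κ k : GL (Fin n) F} (hκ : κ ∈ congruenceGL n γ') (hk : k ∈ congruenceGL n γ) :
    ValBound (γ' * γ) (((κ * k * κ⁻¹ : GL (Fin n) F) : Matrix (Fin n) (Fin n) F) - (k : Matrix (Fin n) (Fin n) F)) := by
  have hc := commutator_mem_congruenceGL hκ hk
  have e : ((κ * k * κ⁻¹ : GL (Fin n) F) : Matrix (Fin n) (Fin n) F) - (k : Matrix (Fin n) (Fin n) F) =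
      (((κ * k * κ⁻¹ * k⁻¹ : GL (Fin n) F) : Matrix (Fin n) (Fin n) F) - 1) * (k : Matrix (Fin n) (Fin n) F) := by
    rw [Matrix.sub_mul, Matrix.one_mul, Units.val_mul (κ * k * κ⁻¹) k⁻¹, Matrix.mul_assoc, ← Units.val_mul k⁻¹, inv_mul_cancel, Units.val_one, Matrix.mul_one]
  rw [e]
  have h1 := hc.2.1.mul hk.1.1
  rwa [mul_one] at h1

/-- Coset form: `(κkκ⁻¹) k⁻¹ ∈ K_{γ'γ}` for `κ ∈ K_{γ'}`, `k ∈ K_γ` — `κkκ⁻¹` and `k` have the same class modulo `K_{γ'γ}` (★ commutator estimate, re-associated).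
[cite: Casselman1995, §1.4 Prop. 1.4.4] -/
theorem conj_mul_inv_mem_congruenceGL {γ γ' : ValueGroupWithZero F} {κ k : GL (Fin n) F} (hκ : κ ∈ congruenceGL n γ') (hk : k ∈ congruenceGL n γ) :
    κ * k * κ⁻¹ * k⁻¹ ∈ congruenceGL n (γ' * γ) :=
  commutator_mem_congruenceGL hκ hk

/-- **EQUIVARIANCE**: for `κ ∈ GL_n(𝒪)` and `v(k − 1) ≤ γ`, the conjugated layer image `κ(k − 1)κ⁻¹ = κkκ⁻¹ − 1` again has entries `≤ γ` (★ `valBound_coe_conj_sub_one`, §1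
`coe_conj_sub_one`): `GL_n(𝒪)` acts on the layer `{v ≤ γ} ⧸ {v ≤ δ}` by `X ↦ κXκ⁻¹`. [cite: Howe1977Kirillov, §1] [cite: HarishChandra1999, §17 p. 80] -/
theorem valBound_coe_mul_sub_one_mul_coe_inv {γ : ValueGroupWithZero F} {κ k : GL (Fin n) F} (hκ : κ ∈ glInt n F)
    (hk : ValBound γ ((k : Matrix (Fin n) (Fin n) F) - 1)) :
    ValBound γ ((κ : Matrix (Fin n) (Fin n) F) * ((k : Matrix (Fin n) (Fin n) F) - 1) * ((κ⁻¹ : GL (Fin n) F) : Matrix (Fin n) (Fin n) F)) := by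
  rw [← coe_conj_sub_one]
  exact valBound_coe_conj_sub_one hκ hk

/-- Equivariance is compatible with the layer classes: if `k⁻¹k' ∈ K_δ` (`k, k' ∈ GL_n(𝒪)`) then `(κkκ⁻¹)⁻¹ (κk'κ⁻¹) ∈ K_δ` for `κ ∈ GL_n(𝒪)` (★ `conj_mem_congruenceGL`). [cite: BernsteinZelevinsky1976, §3] -/
theorem conj_inv_mul_conj_mem_congruenceGL {δ : ValueGroupWithZero F} {κ k k' : GL (Fin n) F} (hκ : κ ∈ glInt n F) (h : k⁻¹ * k' ∈ congruenceGL n δ) :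
    (κ * k * κ⁻¹)⁻¹ * (κ * k' * κ⁻¹) ∈ congruenceGL n δ := by
  have e : (κ * k * κ⁻¹)⁻¹ * (κ * k' * κ⁻¹) = κ * (k⁻¹ * k') * κ⁻¹ := by group
  rw [e]
  exact conj_mem_congruenceGL hκ h

end Layer

/-! ## §5 The `ϖ^m` dictionary: `K_m ⧸ K_{m+e} ≅ M_n(𝒪) ⧸ ϖ^e M_n(𝒪)` element-wise -/

section Uniformizer

variable {ϖ : F}


/-- `v(Z_{ij}) ≤ |ϖ|^e` for all `i, j` **iff** `Z = ϖ^e W` with `W` integral (`ϖ ≠ 0`). [cite: Howe1977Kirillov, §1] -/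
theorem valBound_pow_iff_exists_eq_smul (hϖ0 : ϖ ≠ 0) (e : ℕ) (Z : Matrix (Fin n) (Fin n) F) :
    ValBound (valuation F ϖ ^ e) Z ↔ ∃ W : Matrix (Fin n) (Fin n) F, IsIntegralMatrix W ∧ Z = ϖ ^ e • W := by
  have hpow : ϖ ^ e ≠ 0 := pow_ne_zero _ hϖ0
  have hv : valuation F ϖ ^ e ≠ 0 := pow_ne_zero _ ((Valuation.ne_zero_iff _).mpr hϖ0)
  constructor
  · intro h
    refine ⟨(ϖ ^ e)⁻¹ • Z, fun i j => ?_, by rw [smul_smul, mul_inv_cancel₀ hpow, one_smul]⟩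
    rw [Matrix.smul_apply, smul_eq_mul, Valuation.mem_integer_iff, map_mul, map_inv₀, map_pow]
    calc (valuation F ϖ ^ e)⁻¹ * valuation F (Z i j) ≤ (valuation F ϖ ^ e)⁻¹ * valuation F ϖ ^ e := mul_le_mul_right (h i j) _
      _ = 1 := inv_mul_cancel₀ hv
  · rintro ⟨W, hW, rfl⟩ i j
    rw [Matrix.smul_apply, smul_eq_mul, map_mul, map_pow]
    calc valuation F ϖ ^ e * valuation F (W i j) ≤ valuation F ϖ ^ e * 1 := mul_le_mul_right ((Valuation.mem_integer_iff _ _).mp (hW i j)) _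
      _ = valuation F ϖ ^ e := mul_one _

/-- Rescaling the level: `v(ϖ^m Z) ≤ |ϖ|^{m+e} ⟺ v(Z) ≤ |ϖ|^e` (`ϖ ≠ 0`). [folklore] -/
theorem valBound_pow_add_smul_iff (hϖ0 : ϖ ≠ 0) (m e : ℕ) (Z : Matrix (Fin n) (Fin n) F) :
    ValBound (valuation F ϖ ^ (m + e)) (ϖ ^ m • Z) ↔ ValBound (valuation F ϖ ^ e) Z := by
  have hv : 0 < valuation F ϖ ^ m := pow_pos ((Valuation.pos_iff _).mpr hϖ0) _
  refine forall_congr' fun i => forall_congr' fun j => ?_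
  rw [Matrix.smul_apply, smul_eq_mul, map_mul, map_pow, pow_add, mul_le_mul_iff_right₀ hv]

omit [ValuativeRel F] in
/-- The product of two layer representatives: `(1 + ϖ^m X)(1 + ϖ^m Y) = 1 + ϖ^m (X + Y) + ϖ^{m+m} (XY)` in `M_n(F)`. [cite: Howe1977Kirillov, §1] -/
theorem one_add_smul_mul_one_add_smul (m : ℕ) (X Y : Matrix (Fin n) (Fin n) F) :
    (1 + ϖ ^ m • X) * (1 + ϖ ^ m • Y) = 1 + ϖ ^ m • (X + Y) + ϖ ^ (m + m) • (X * Y) := by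
  rw [add_mul, one_mul, mul_add, mul_one, Matrix.smul_mul, Matrix.mul_smul, smul_smul, ← pow_add, smul_add]
  abel

/-- **`K_m ⧸ K_{m+e}` READ ON `M_n(𝒪) ⧸ ϖ^e`**: for `k, k' ∈ GL_n(F)` with matrices `1 + ϖ^m X`, `1 + ϖ^m Y` (`X, Y` integral, `m ≥ 1`, `ϖ` a uniformizer),
`k⁻¹ k' ∈ K_{m+e} ⟺ v(Y − X) ≤ |ϖ|^e ⟺ Y − X ∈ ϖ^e M_n(𝒪)` (§2 + rescaling).  With `e = m`: the layer `K_m ⧸ K_{2m}` is parametrised by `M_n(𝒪 ⧸ ϖ^m)`.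
[cite: Howe1977Kirillov, §1] [cite: HarishChandra1999, §17 p. 80] -/
theorem inv_mul_mem_congruenceGL_pow_add_iff (hϖ : IsUniformizingElement ϖ) {m : ℕ} (hm : 1 ≤ m) (e : ℕ) {k k' : GL (Fin n) F} {X Y : Matrix (Fin n) (Fin n) F}
    (hX : IsIntegralMatrix X) (hY : IsIntegralMatrix Y) (hk : (k : Matrix (Fin n) (Fin n) F) = 1 + ϖ ^ m • X) (hk' : (k' : Matrix (Fin n) (Fin n) F) = 1 + ϖ ^ m • Y) :
    k⁻¹ * k' ∈ congruenceGL n (valuation F ϖ ^ (m + e)) ↔ ValBound (valuation F ϖ ^ e) (Y - X) := by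
  have hkm := mem_congruenceGL_of_coe_eq_one_add_smul hϖ hm hX hk
  have hk'm := mem_congruenceGL_of_coe_eq_one_add_smul hϖ hm hY hk'
  rw [inv_mul_mem_congruenceGL_iff_valBound_sub (congruenceGL_le_glInt _ hkm) (congruenceGL_le_glInt _ hk'm), hk, hk', add_sub_add_left_eq_sub, ← smul_sub,
    valBound_pow_add_smul_iff hϖ.ne_zero]

/-- The same with the conclusion `Y − X ∈ ϖ^e M_n(𝒪)` spelled out. [cite: Howe1977Kirillov, §1] -/
theorem inv_mul_mem_congruenceGL_pow_add_iff_exists (hϖ : IsUniformizingElement ϖ) {m : ℕ} (hm : 1 ≤ m) (e : ℕ) {k k' : GL (Fin n) F} {X Y : Matrix (Fin n) (Fin n) F}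
    (hX : IsIntegralMatrix X) (hY : IsIntegralMatrix Y) (hk : (k : Matrix (Fin n) (Fin n) F) = 1 + ϖ ^ m • X) (hk' : (k' : Matrix (Fin n) (Fin n) F) = 1 + ϖ ^ m • Y) :
    k⁻¹ * k' ∈ congruenceGL n (valuation F ϖ ^ (m + e)) ↔ ∃ W : Matrix (Fin n) (Fin n) F, IsIntegralMatrix W ∧ Y - X = ϖ ^ e • W := by
  rw [inv_mul_mem_congruenceGL_pow_add_iff hϖ hm e hX hY hk hk', valBound_pow_iff_exists_eq_smul hϖ.ne_zero]

/-- **THE LAYER MAP IS A HOMOMORPHISM `K_m → M_n(𝒪) ⧸ ϖ^m`**: with `k = 1 + ϖ^m X`, `k' = 1 + ϖ^m Y`, `l = 1 + ϖ^m (X + Y)` (`X, Y` integral, `m ≥ 1`): `(kk')⁻¹ l ∈ K_{2m}`, i.e.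
`kk' ≡ 1 + ϖ^m(X + Y) (mod K_{2m})`. [cite: Howe1977Kirillov, §1] [cite: Casselman1995, §1.4 Prop. 1.4.4] -/
theorem mul_inv_mul_mem_congruenceGL_pow_two_mul (hϖ : IsUniformizingElement ϖ) {m : ℕ} (hm : 1 ≤ m) {k k' l : GL (Fin n) F} {X Y : Matrix (Fin n) (Fin n) F}
    (hX : IsIntegralMatrix X) (hY : IsIntegralMatrix Y) (hk : (k : Matrix (Fin n) (Fin n) F) = 1 + ϖ ^ m • X) (hk' : (k' : Matrix (Fin n) (Fin n) F) = 1 + ϖ ^ m • Y)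
    (hl : (l : Matrix (Fin n) (Fin n) F) = 1 + ϖ ^ m • (X + Y)) :
    (k * k')⁻¹ * l ∈ congruenceGL n (valuation F ϖ ^ (m + m)) := by
  have hkm := mem_congruenceGL_of_coe_eq_one_add_smul hϖ hm hX hk
  have hk'm := mem_congruenceGL_of_coe_eq_one_add_smul hϖ hm hY hk'
  have hlm := mem_congruenceGL_of_coe_eq_one_add_smul hϖ hm (fun i j => add_mem (hX i j) (hY i j)) hl
  rw [inv_mul_mem_congruenceGL_iff_valBound_sub (Subgroup.mul_mem _ (congruenceGL_le_glInt _ hkm) (congruenceGL_le_glInt _ hk'm)) (congruenceGL_le_glInt _ hlm),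
    Units.val_mul, hk, hk', hl, one_add_smul_mul_one_add_smul]
  have e : 1 + ϖ ^ m • (X + Y) - (1 + ϖ ^ m • (X + Y) + ϖ ^ (m + m) • (X * Y)) = ϖ ^ (m + m) • (-(X * Y)) := by
    rw [smul_neg]; abel
  rw [e]
  exact (valBound_pow_iff_exists_eq_smul hϖ.ne_zero (m + m) _).2 ⟨-(X * Y), fun i j => neg_mem (hX.mul hY i j), rfl⟩

/-- **INVERSES ON THE LAYER**: with `k = 1 + ϖ^m X`, `l = 1 + ϖ^m (−X)` (`X` integral, `m ≥ 1`): `k l ∈ K_{2m}`, i.e. `k⁻¹ ≡ 1 − ϖ^m X (mod K_{2m})`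
(`kl = 1 − ϖ^{2m} X²`). [cite: Howe1977Kirillov, §1] [cite: Casselman1995, §1.4 Prop. 1.4.4] -/
theorem mul_mem_congruenceGL_pow_two_mul_of_neg (hϖ : IsUniformizingElement ϖ) {m : ℕ} (hm : 1 ≤ m) {k l : GL (Fin n) F} {X : Matrix (Fin n) (Fin n) F}
    (hX : IsIntegralMatrix X) (hk : (k : Matrix (Fin n) (Fin n) F) = 1 + ϖ ^ m • X) (hl : (l : Matrix (Fin n) (Fin n) F) = 1 + ϖ ^ m • (-X)) :
    k * l ∈ congruenceGL n (valuation F ϖ ^ (m + m)) := by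
  have hkm := mem_congruenceGL_of_coe_eq_one_add_smul hϖ hm hX hk
  have hlm := mem_congruenceGL_of_coe_eq_one_add_smul hϖ hm (fun i j => neg_mem (hX i j)) hl
  rw [mem_congruenceGL_iff_valBound_sub_one_of_mem_glInt (Subgroup.mul_mem _ (congruenceGL_le_glInt _ hkm) (congruenceGL_le_glInt _ hlm)), Units.val_mul, hk, hl,
    one_add_smul_mul_one_add_smul]
  have e : 1 + ϖ ^ m • (X + -X) + ϖ ^ (m + m) • (X * -X) - 1 = ϖ ^ (m + m) • (-(X * X)) := by
    rw [add_neg_cancel, smul_zero, add_zero, add_sub_cancel_left, Matrix.mul_neg]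
  rw [e]
  exact (valBound_pow_iff_exists_eq_smul hϖ.ne_zero (m + m) _).2 ⟨-(X * X), fun i j => neg_mem (hX.mul hX i j), rfl⟩

omit [ValuativeRel F] in
/-- **CONJUGATION ON THE LAYER REPRESENTATIVES**: `κ (1 + ϖ^m X) κ⁻¹ = 1 + ϖ^m (κ X κ⁻¹)` exactly, in `M_n(F)`. [cite: Howe1977Kirillov, §1] [cite: HarishChandra1999, §17 p. 80] -/
theorem coe_conj_eq_one_add_smul (m : ℕ) {κ k : GL (Fin n) F} {X : Matrix (Fin n) (Fin n) F} (hk : (k : Matrix (Fin n) (Fin n) F) = 1 + ϖ ^ m • X) :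
    ((κ * k * κ⁻¹ : GL (Fin n) F) : Matrix (Fin n) (Fin n) F) =
      1 + ϖ ^ m • ((κ : Matrix (Fin n) (Fin n) F) * X * ((κ⁻¹ : GL (Fin n) F) : Matrix (Fin n) (Fin n) F)) := by
  rw [← sub_eq_iff_eq_add', coe_conj_sub_one, hk, add_sub_cancel_left, Matrix.mul_smul, Matrix.smul_mul]

/-- … and `κ X κ⁻¹` is again integral for `κ ∈ GL_n(𝒪)`: the action of `GL_n(𝒪)` on `K_m ⧸ K_{m+e} ≅ M_n(𝒪 ⧸ ϖ^e)` is `X ↦ κXκ⁻¹ (mod ϖ^e)`. [cite: Howe1977Kirillov, §1] -/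
theorem isIntegralMatrix_coe_mul_mul_coe_inv {κ : GL (Fin n) F} (hκ : κ ∈ glInt n F) {X : Matrix (Fin n) (Fin n) F} (hX : IsIntegralMatrix X) :
    IsIntegralMatrix ((κ : Matrix (Fin n) (Fin n) F) * X * ((κ⁻¹ : GL (Fin n) F) : Matrix (Fin n) (Fin n) F)) :=
  ((isIntegralMatrix_of_mem_glInt hκ).mul hX).mul (isIntegralMatrix_of_mem_glInt (Subgroup.inv_mem _ hκ))

/-- **`K_m` ACTS TRIVIALLY ON `K_m ⧸ K_{2m}`** in the `ϖ^m` currency: for `κ ∈ K_m` and `k = 1 + ϖ^m X` (`X` integral, `m ≥ 1`), `κ X κ⁻¹ − X ∈ ϖ^m M_n(𝒪)` — equivalently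
`k⁻¹ (κkκ⁻¹) ∈ K_{2m}` (§4 `valBound_coe_conj_sub_coe` + §2 + ★ normality). [cite: Howe1977Kirillov, §1] [cite: Casselman1995, §1.4 Prop. 1.4.4] -/
theorem inv_mul_conj_mem_congruenceGL_pow_two_mul (hϖ : IsUniformizingElement ϖ) {m : ℕ} (hm : 1 ≤ m) {κ k : GL (Fin n) F} {X : Matrix (Fin n) (Fin n) F}
    (hκ : κ ∈ congruenceGL n (valuation F ϖ ^ m)) (hX : IsIntegralMatrix X) (hk : (k : Matrix (Fin n) (Fin n) F) = 1 + ϖ ^ m • X) :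
    k⁻¹ * (κ * k * κ⁻¹) ∈ congruenceGL n (valuation F ϖ ^ (m + m)) := by
  have hkm := mem_congruenceGL_of_coe_eq_one_add_smul hϖ hm hX hk
  have hconj : κ * k * κ⁻¹ ∈ glInt n F := congruenceGL_le_glInt _ (conj_mem_congruenceGL (congruenceGL_le_glInt _ hκ) hkm)
  rw [inv_mul_mem_congruenceGL_iff_valBound_sub (congruenceGL_le_glInt _ hkm) hconj, pow_add]
  exact valBound_coe_conj_sub_coe hκ hkm

end Uniformizer

end Summit.HodgeConjecture.HodgeConjecture.Cruxes.H413.K2E3CongruenceLayersGL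

end
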